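import Mathlib
import HarnessLib
import Summits.Ventures.LatticeQCDFlow.Exactness.IMHCoupledEstimatorErrorBar
import Summits.Ventures.LatticeQCDFlow.Scaling.AutoregressiveGaugeHeatBathColdExact

/-!
# LatticeQCDFlow / Scaling — the between-pair error bar of the coupled estimator of the exact one-plaquette heat-bath sampler (`A = Z/(c^{#B}M^k)`) is honest: `E[SE²] = Var(H̄)` exactly and the true mean-square error exceeds it by at most `((1 − A)^{k+N}(c − a))²`

HONEST FRAMING: exact (Metropolis-corrected) sampling algorithms for lattice gauge theory;
figures of merit are autocorrelation/cost numbers at stated couplings and volumes; no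
continuum-physics claim.

Venture `LatticeQCDFlow` (cell pub-lqcd), topic `Scaling`, FANOUT row 30 (lean-1, GEN-38) — OUR WORK, the gauge instance of this
generation's abstract `Exactness/IMHCoupledEstimatorErrorBar` for the exact one-plaquette heat-bath sampler (`A = Z/(c^{#B}M^k)`).  Setting as in
`Scaling/AutoregressiveGauge…CommonRandomNumbers` (GEN-36): the CRN pair kernel `K̂` feeds the SAME proposals and uniforms to two runs;
`A` is the sampler's acceptance at the cold configuration (displayed), `1/A` its cold weight.
`R ≥ 2` pairwise independent coupled pairs on one probability space, each a CRN pair chain of the sampler; `H̄` the grand mean of the coupled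
estimates `H(Z_j) = f(U_k) + Σ_{n<N}(f(U′_{k+n}) − f(U_{k+n}))`, `SE² = Σ_j (H(Z_j) − H̄)²/(R(R − 1))` the printed squared standard error
(row 11's `replicaSEsq`), `a ≤ f ≤ c` measurable:

* **`heatBath_crnLag_replicas_mse_sub_SEsq_mem_Icc`** — pairs from ONE initial coupling one update ahead: `E(H̄ − π f)² − E[SE²] ∈ [0, ((1 − A)^{k+N}(c − a))²]`
  — the printed error bar is honest up to the squared truncation bias, with no autocorrelation time and no window;
* **`heatBath_crnLag_replicas_SEsq_le`** — `E[SE²] ≤ [Var_π f + (1 − A)^k(c − a)²(2/A² + 1/A + 1)]/R`;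
* **`heatBath_crnLag_replicas_mse_le_SEsq_add`** — pairs from DIFFERENT initial couplings (each one update ahead): `E(H̄ − π f)² ≤ E[SE²] + ((1 − A)^{k+N}(c − a))²`.

NOT CLAIMED: the sampling distribution of `SE²`; coverage beyond Chebyshev; any value of `A`.  No `def`, no `sorry`, nothing cited as a fact.
-/

noncomputable section

namespace Summit.Ventures.LatticeQCDFlow.Theory2.Autoregressive

open MeasureTheory ProbabilityTheory Function Finset
open scoped ENNReal unitInterval
open Literature.MathematicalPhysics.QuantumFieldTheory Literature.MathematicalPhysics.QuantumLattice
open Summit.Ventures.LatticeQCDFlow.Exactness Summit.Ventures.LatticeQCDFlow.Scoring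

variable {d L : ℕ} [NeZero L] {G : Type*} [Group G] [TopologicalSpace G] [IsTopologicalGroup G]
  [CompactSpace G] [SecondCountableTopology G] [MeasurableSpace G] [BorelSpace G]

/-- **HONEST UP TO THE SQUARED TRUNCATION BIAS**: `E(H̄ − π f)² − E[SE²] ∈ [0, ((1 − A)^{k+N}(c − a))²]` (the exact one-plaquette heat-bath sampler (`A = Z/(c^{#B}M^k)`)). [ours] -/
theorem heatBath_crnLag_replicas_mse_sub_SEsq_mem_Icc [MeasurableSingletonClass G] (hL : 2 ≤ L) {w : G → ℝ} (hw : Continuous w) {m M : ℝ} (hm0 : 0 < m)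
    (hm : ∀ g, m ≤ w g) (hM : ∀ g, w g ≤ M) (hw1 : w 1 = M)
    (B : Finset (Plaquette d L)) (t : Plaquette d L → Edge d L)
    (ht : ∀ p ∈ B, t p ∈ ({(p.1, p.2.1.1), (p.1.shift p.2.1.1, p.2.1.2),
        (p.1.shift p.2.1.2, p.2.1.1), (p.1, p.2.1.2)} : Finset (Edge d L)))
    (rank : Plaquette d L → ℕ)
    (hrank : ∀ p ∈ B, ∀ p' ∈ B, p ≠ p' → t p ∈ ({(p'.1, p'.2.1.1), (p'.1.shift p'.2.1.1, p'.2.1.2),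
        (p'.1.shift p'.2.1.2, p'.2.1.1), (p'.1, p'.2.1.2)} : Finset (Edge d L)) → rank p < rank p')
    (π q : Measure (GaugeConfig d L G)) [IsProbabilityMeasure π] [IsProbabilityMeasure q]
    (hπ : π = (Measure.pi fun _ : Edge d L => haarProbability G).withDensity fun U =>
      ENNReal.ofReal ((∏ p : Plaquette d L, w (plaquetteHolonomy U p.1 p.2.1.1 p.2.1.2)) /
        ∫ V, ∏ p : Plaquette d L, w (plaquetteHolonomy V p.1 p.2.1.1 p.2.1.2)
          ∂(Measure.pi fun _ : Edge d L => haarProbability G)))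
    (hq : q = (Measure.pi fun _ : Edge d L => haarProbability G).withDensity fun U =>
      ENNReal.ofReal ((∏ p ∈ B, w (plaquetteHolonomy U p.1 p.2.1.1 p.2.1.2)) /
        ∫ V, ∏ p ∈ B, w (plaquetteHolonomy V p.1 p.2.1.1 p.2.1.2)
          ∂(Measure.pi fun _ : Edge d L => haarProbability G)))
    [Fact (Measurable (fun U =>
        ((∫ V, ∏ p : Plaquette d L, w (plaquetteHolonomy V p.1 p.2.1.1 p.2.1.2) ∂(Measure.pi fun _ : Edge d L => haarProbability G)) /
          ((∫ V, ∏ p ∈ B, w (plaquetteHolonomy V p.1 p.2.1.1 p.2.1.2)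
            ∂(Measure.pi fun _ : Edge d L => haarProbability G)) *
            ∏ p ∈ Finset.univ \ B, w (plaquetteHolonomy U p.1 p.2.1.1 p.2.1.2)))⁻¹))]
    (Khat : Kernel (GaugeConfig d L G × GaugeConfig d L G) (GaugeConfig d L G × GaugeConfig d L G))
    [IsMarkovKernel Khat]
    (hK : ∀ z : GaugeConfig d L G × GaugeConfig d L G, Khat z =
      (q.prod (volume : Measure unitInterval)).map (fun p : GaugeConfig d L G × unitInterval =>
        ((if (p.2 : ℝ) * (fun U =>
        ((∫ V, ∏ p : Plaquette d L, w (plaquetteHolonomy V p.1 p.2.1.1 p.2.1.2) ∂(Measure.pi fun _ : Edge d L => haarProbability G)) /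
          ((∫ V, ∏ p ∈ B, w (plaquetteHolonomy V p.1 p.2.1.1 p.2.1.2)
            ∂(Measure.pi fun _ : Edge d L => haarProbability G)) *
            ∏ p ∈ Finset.univ \ B, w (plaquetteHolonomy U p.1 p.2.1.1 p.2.1.2)))⁻¹) z.1 ≤ (fun U =>
        ((∫ V, ∏ p : Plaquette d L, w (plaquetteHolonomy V p.1 p.2.1.1 p.2.1.2) ∂(Measure.pi fun _ : Edge d L => haarProbability G)) /
          ((∫ V, ∏ p ∈ B, w (plaquetteHolonomy V p.1 p.2.1.1 p.2.1.2)
            ∂(Measure.pi fun _ : Edge d L => haarProbability G)) *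
            ∏ p ∈ Finset.univ \ B, w (plaquetteHolonomy U p.1 p.2.1.1 p.2.1.2)))⁻¹) p.1 then p.1 else z.1),
          (if (p.2 : ℝ) * (fun U =>
        ((∫ V, ∏ p : Plaquette d L, w (plaquetteHolonomy V p.1 p.2.1.1 p.2.1.2) ∂(Measure.pi fun _ : Edge d L => haarProbability G)) /
          ((∫ V, ∏ p ∈ B, w (plaquetteHolonomy V p.1 p.2.1.1 p.2.1.2)
            ∂(Measure.pi fun _ : Edge d L => haarProbability G)) *
            ∏ p ∈ Finset.univ \ B, w (plaquetteHolonomy U p.1 p.2.1.1 p.2.1.2)))⁻¹) z.2 ≤ (fun U =>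
        ((∫ V, ∏ p : Plaquette d L, w (plaquetteHolonomy V p.1 p.2.1.1 p.2.1.2) ∂(Measure.pi fun _ : Edge d L => haarProbability G)) /
          ((∫ V, ∏ p ∈ B, w (plaquetteHolonomy V p.1 p.2.1.1 p.2.1.2)
            ∂(Measure.pi fun _ : Edge d L => haarProbability G)) *
            ∏ p ∈ Finset.univ \ B, w (plaquetteHolonomy U p.1 p.2.1.1 p.2.1.2)))⁻¹) p.1 then p.1 else z.2))))
{Ω' : Type*} {mΩ' : MeasurableSpace Ω'} {μ : Measure Ω'} [IsProbabilityMeasure μ]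
    {Z : ℕ → Ω' → (ℕ → GaugeConfig d L G × GaugeConfig d L G)} {R : ℕ} (ν : Measure (GaugeConfig d L G × GaugeConfig d L G)) [IsProbabilityMeasure ν]
    (hlagν : ν.map Prod.fst = (ν.map Prod.snd).bind (indepMH q (fun U =>
        ((∫ V, ∏ p : Plaquette d L, w (plaquetteHolonomy V p.1 p.2.1.1 p.2.1.2) ∂(Measure.pi fun _ : Edge d L => haarProbability G)) /
          ((∫ V, ∏ p ∈ B, w (plaquetteHolonomy V p.1 p.2.1.1 p.2.1.2)
            ∂(Measure.pi fun _ : Edge d L => haarProbability G)) *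
            ∏ p ∈ Finset.univ \ B, w (plaquetteHolonomy U p.1 p.2.1.1 p.2.1.2)))⁻¹)))
    {f : GaugeConfig d L G → ℝ} (hf : Measurable f) {a c : ℝ} (ha : ∀ x, a ≤ f x) (hc : ∀ x, f x ≤ c) (k N : ℕ) (hR : 2 ≤ R)
    (hZm : ∀ j, Measurable (Z j))
    (hlaw : ∀ j < R, μ.map (Z j) = Kernel.trajMeasure (X := fun _ : ℕ => GaugeConfig d L G × GaugeConfig d L G) ν
      (fun n : ℕ => Khat.comap (fun h : (i : ↥(Finset.Iic n)) → GaugeConfig d L G × GaugeConfig d L G => h ⟨n, Finset.mem_Iic.2 le_rfl⟩)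
        (measurable_pi_apply _)))
    (hind : ∀ i < R, ∀ j < R, i ≠ j → IndepFun (Z i) (Z j) μ) :
    ∫ ω, (replicaMean (fun j ω => f ((Z j ω k).2) + ∑ n ∈ range N, (f ((Z j ω (k + n)).1) - f ((Z j ω (k + n)).2))) R ω -
        ∫ x, f x ∂(π)) ^ 2 ∂μ -
      μ[replicaSEsq (fun j ω => f ((Z j ω k).2) + ∑ n ∈ range N, (f ((Z j ω (k + n)).1) - f ((Z j ω (k + n)).2))) R] ∈
      Set.Icc 0 (((1 - (((∫ V, ∏ p : Plaquette d L, w (plaquetteHolonomy V p.1 p.2.1.1 p.2.1.2) ∂(Measure.pi fun _ : Edge d L => haarProbability G)) /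
        ((∫ g, w g ∂(haarProbability G)) ^ B.card * M ^ (Finset.univ \ B).card)))) ^ (k + N) * (c - a)) ^ 2) := by
  obtain ⟨hA, hρq, hmax, hρm, hρpos⟩ := heatBath_cold_acceptMass_eq hL hw hm0 hm hM hw1 B t ht rank hrank π q hπ hq
  set cold : GaugeConfig d L G := fun _ => (1 : G) with hcold
  set ρ : GaugeConfig d L G → ℝ := fun U => ((∫ V, ∏ p : Plaquette d L, w (plaquetteHolonomy V p.1 p.2.1.1 p.2.1.2) ∂(Measure.pi fun _ : Edge d L => haarProbability G)) /
          ((∫ V, ∏ p ∈ B, w (plaquetteHolonomy V p.1 p.2.1.1 p.2.1.2)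
            ∂(Measure.pi fun _ : Edge d L => haarProbability G)) *
            ∏ p ∈ Finset.univ \ B, w (plaquetteHolonomy U p.1 p.2.1.1 p.2.1.2))) with hρ
  have hw0' : ∀ U, 0 < (ρ U)⁻¹ := fun U => inv_pos.2 (hρpos U)
  have hπ' : (q.withDensity fun U => ENNReal.ofReal (ρ U)⁻¹) = π := withDensity_inv_density hρm hρpos hρq
  haveI : IsProbabilityMeasure (q.withDensity fun U => ENNReal.ofReal (ρ U)⁻¹) := by rw [hπ']; infer_instance
  have hone : ∫⁻ y, ENNReal.ofReal (ρ y)⁻¹ ∂q = ENNReal.ofReal 1 := by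
    have h : π Set.univ = 1 := measure_univ
    rw [← hπ', withDensity_apply _ MeasurableSet.univ, Measure.restrict_univ] at h
    rw [h, ENNReal.ofReal_one]
  have hA' := imhAcceptMass_toReal_eq_of_forall_le (q := q) hw0' cold hmax zero_le_one hone
  have hrate : ((ρ cold)⁻¹)⁻¹ = ((∫ V, ∏ p : Plaquette d L, w (plaquetteHolonomy V p.1 p.2.1.1 p.2.1.2) ∂(Measure.pi fun _ : Edge d L => haarProbability G)) /
        ((∫ g, w g ∂(haarProbability G)) ^ B.card * M ^ (Finset.univ \ B).card)) := by
    rw [← hA, hA', one_div]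
  have h := crnLag_replicas_mse_sub_SEsq_mem_Icc (q := q) ν hw0' hmax Khat hK hlagν hf ha hc k N hR hZm hlaw hind (x₀ := cold)
  rw [hrate] at h
  rw [hπ'] at h
  exact h

/-- **`E[SE²] ≤ [Var_π f + (1 − A)^k(c − a)²(2/A² + 1/A + 1)]/R`** (the exact one-plaquette heat-bath sampler (`A = Z/(c^{#B}M^k)`)). [ours] -/
theorem heatBath_crnLag_replicas_SEsq_le [MeasurableSingletonClass G] (hL : 2 ≤ L) {w : G → ℝ} (hw : Continuous w) {m M : ℝ} (hm0 : 0 < m)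
    (hm : ∀ g, m ≤ w g) (hM : ∀ g, w g ≤ M) (hw1 : w 1 = M)
    (B : Finset (Plaquette d L)) (t : Plaquette d L → Edge d L)
    (ht : ∀ p ∈ B, t p ∈ ({(p.1, p.2.1.1), (p.1.shift p.2.1.1, p.2.1.2),
        (p.1.shift p.2.1.2, p.2.1.1), (p.1, p.2.1.2)} : Finset (Edge d L)))
    (rank : Plaquette d L → ℕ)
    (hrank : ∀ p ∈ B, ∀ p' ∈ B, p ≠ p' → t p ∈ ({(p'.1, p'.2.1.1), (p'.1.shift p'.2.1.1, p'.2.1.2),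
        (p'.1.shift p'.2.1.2, p'.2.1.1), (p'.1, p'.2.1.2)} : Finset (Edge d L)) → rank p < rank p')
    (π q : Measure (GaugeConfig d L G)) [IsProbabilityMeasure π] [IsProbabilityMeasure q]
    (hπ : π = (Measure.pi fun _ : Edge d L => haarProbability G).withDensity fun U =>
      ENNReal.ofReal ((∏ p : Plaquette d L, w (plaquetteHolonomy U p.1 p.2.1.1 p.2.1.2)) /
        ∫ V, ∏ p : Plaquette d L, w (plaquetteHolonomy V p.1 p.2.1.1 p.2.1.2)
          ∂(Measure.pi fun _ : Edge d L => haarProbability G)))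
    (hq : q = (Measure.pi fun _ : Edge d L => haarProbability G).withDensity fun U =>
      ENNReal.ofReal ((∏ p ∈ B, w (plaquetteHolonomy U p.1 p.2.1.1 p.2.1.2)) /
        ∫ V, ∏ p ∈ B, w (plaquetteHolonomy V p.1 p.2.1.1 p.2.1.2)
          ∂(Measure.pi fun _ : Edge d L => haarProbability G)))
    [Fact (Measurable (fun U =>
        ((∫ V, ∏ p : Plaquette d L, w (plaquetteHolonomy V p.1 p.2.1.1 p.2.1.2) ∂(Measure.pi fun _ : Edge d L => haarProbability G)) /
          ((∫ V, ∏ p ∈ B, w (plaquetteHolonomy V p.1 p.2.1.1 p.2.1.2)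
            ∂(Measure.pi fun _ : Edge d L => haarProbability G)) *
            ∏ p ∈ Finset.univ \ B, w (plaquetteHolonomy U p.1 p.2.1.1 p.2.1.2)))⁻¹))]
    (Khat : Kernel (GaugeConfig d L G × GaugeConfig d L G) (GaugeConfig d L G × GaugeConfig d L G))
    [IsMarkovKernel Khat]
    (hK : ∀ z : GaugeConfig d L G × GaugeConfig d L G, Khat z =
      (q.prod (volume : Measure unitInterval)).map (fun p : GaugeConfig d L G × unitInterval =>
        ((if (p.2 : ℝ) * (fun U =>
        ((∫ V, ∏ p : Plaquette d L, w (plaquetteHolonomy V p.1 p.2.1.1 p.2.1.2) ∂(Measure.pi fun _ : Edge d L => haarProbability G)) /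
          ((∫ V, ∏ p ∈ B, w (plaquetteHolonomy V p.1 p.2.1.1 p.2.1.2)
            ∂(Measure.pi fun _ : Edge d L => haarProbability G)) *
            ∏ p ∈ Finset.univ \ B, w (plaquetteHolonomy U p.1 p.2.1.1 p.2.1.2)))⁻¹) z.1 ≤ (fun U =>
        ((∫ V, ∏ p : Plaquette d L, w (plaquetteHolonomy V p.1 p.2.1.1 p.2.1.2) ∂(Measure.pi fun _ : Edge d L => haarProbability G)) /
          ((∫ V, ∏ p ∈ B, w (plaquetteHolonomy V p.1 p.2.1.1 p.2.1.2)
            ∂(Measure.pi fun _ : Edge d L => haarProbability G)) *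
            ∏ p ∈ Finset.univ \ B, w (plaquetteHolonomy U p.1 p.2.1.1 p.2.1.2)))⁻¹) p.1 then p.1 else z.1),
          (if (p.2 : ℝ) * (fun U =>
        ((∫ V, ∏ p : Plaquette d L, w (plaquetteHolonomy V p.1 p.2.1.1 p.2.1.2) ∂(Measure.pi fun _ : Edge d L => haarProbability G)) /
          ((∫ V, ∏ p ∈ B, w (plaquetteHolonomy V p.1 p.2.1.1 p.2.1.2)
            ∂(Measure.pi fun _ : Edge d L => haarProbability G)) *
            ∏ p ∈ Finset.univ \ B, w (plaquetteHolonomy U p.1 p.2.1.1 p.2.1.2)))⁻¹) z.2 ≤ (fun U =>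
        ((∫ V, ∏ p : Plaquette d L, w (plaquetteHolonomy V p.1 p.2.1.1 p.2.1.2) ∂(Measure.pi fun _ : Edge d L => haarProbability G)) /
          ((∫ V, ∏ p ∈ B, w (plaquetteHolonomy V p.1 p.2.1.1 p.2.1.2)
            ∂(Measure.pi fun _ : Edge d L => haarProbability G)) *
            ∏ p ∈ Finset.univ \ B, w (plaquetteHolonomy U p.1 p.2.1.1 p.2.1.2)))⁻¹) p.1 then p.1 else z.2))))
{Ω' : Type*} {mΩ' : MeasurableSpace Ω'} {μ : Measure Ω'} [IsProbabilityMeasure μ]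
    {Z : ℕ → Ω' → (ℕ → GaugeConfig d L G × GaugeConfig d L G)} {R : ℕ} (ν : Measure (GaugeConfig d L G × GaugeConfig d L G)) [IsProbabilityMeasure ν]
    {f : GaugeConfig d L G → ℝ} (hf : Measurable f) {a c : ℝ} (ha : ∀ x, a ≤ f x) (hc : ∀ x, f x ≤ c) (k N : ℕ) (hR : 2 ≤ R)
    (hZm : ∀ j, Measurable (Z j))
    (hlaw : ∀ j < R, μ.map (Z j) = Kernel.trajMeasure (X := fun _ : ℕ => GaugeConfig d L G × GaugeConfig d L G) ν
      (fun n : ℕ => Khat.comap (fun h : (i : ↥(Finset.Iic n)) → GaugeConfig d L G × GaugeConfig d L G => h ⟨n, Finset.mem_Iic.2 le_rfl⟩)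
        (measurable_pi_apply _)))
    (hind : ∀ i < R, ∀ j < R, i ≠ j → IndepFun (Z i) (Z j) μ) :
    μ[replicaSEsq (fun j ω => f ((Z j ω k).2) + ∑ n ∈ range N, (f ((Z j ω (k + n)).1) - f ((Z j ω (k + n)).2))) R] ≤
      (∫ y, (f y - ∫ x, f x ∂(π)) ^ 2
          ∂(π) +
        (1 - (((∫ V, ∏ p : Plaquette d L, w (plaquetteHolonomy V p.1 p.2.1.1 p.2.1.2) ∂(Measure.pi fun _ : Edge d L => haarProbability G)) /
        ((∫ g, w g ∂(haarProbability G)) ^ B.card * M ^ (Finset.univ \ B).card)))) ^ k * (c - a) ^ 2 * (2 * (((∫ V, ∏ p : Plaquette d L, w (plaquetteHolonomy V p.1 p.2.1.1 p.2.1.2) ∂(Measure.pi fun _ : Edge d L => haarProbability G)) /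
        ((∫ g, w g ∂(haarProbability G)) ^ B.card * M ^ (Finset.univ \ B).card)))⁻¹ ^ 2 + (((∫ V, ∏ p : Plaquette d L, w (plaquetteHolonomy V p.1 p.2.1.1 p.2.1.2) ∂(Measure.pi fun _ : Edge d L => haarProbability G)) /
        ((∫ g, w g ∂(haarProbability G)) ^ B.card * M ^ (Finset.univ \ B).card)))⁻¹ + 1)) / R := by
  obtain ⟨hA, hρq, hmax, hρm, hρpos⟩ := heatBath_cold_acceptMass_eq hL hw hm0 hm hM hw1 B t ht rank hrank π q hπ hq
  set cold : GaugeConfig d L G := fun _ => (1 : G) with hcold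
  set ρ : GaugeConfig d L G → ℝ := fun U => ((∫ V, ∏ p : Plaquette d L, w (plaquetteHolonomy V p.1 p.2.1.1 p.2.1.2) ∂(Measure.pi fun _ : Edge d L => haarProbability G)) /
          ((∫ V, ∏ p ∈ B, w (plaquetteHolonomy V p.1 p.2.1.1 p.2.1.2)
            ∂(Measure.pi fun _ : Edge d L => haarProbability G)) *
            ∏ p ∈ Finset.univ \ B, w (plaquetteHolonomy U p.1 p.2.1.1 p.2.1.2))) with hρ
  have hw0' : ∀ U, 0 < (ρ U)⁻¹ := fun U => inv_pos.2 (hρpos U)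
  have hπ' : (q.withDensity fun U => ENNReal.ofReal (ρ U)⁻¹) = π := withDensity_inv_density hρm hρpos hρq
  haveI : IsProbabilityMeasure (q.withDensity fun U => ENNReal.ofReal (ρ U)⁻¹) := by rw [hπ']; infer_instance
  have hone : ∫⁻ y, ENNReal.ofReal (ρ y)⁻¹ ∂q = ENNReal.ofReal 1 := by
    have h : π Set.univ = 1 := measure_univ
    rw [← hπ', withDensity_apply _ MeasurableSet.univ, Measure.restrict_univ] at h
    rw [h, ENNReal.ofReal_one]
  have hA' := imhAcceptMass_toReal_eq_of_forall_le (q := q) hw0' cold hmax zero_le_one hone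
  have hrate : ((ρ cold)⁻¹)⁻¹ = ((∫ V, ∏ p : Plaquette d L, w (plaquetteHolonomy V p.1 p.2.1.1 p.2.1.2) ∂(Measure.pi fun _ : Edge d L => haarProbability G)) /
        ((∫ g, w g ∂(haarProbability G)) ^ B.card * M ^ (Finset.univ \ B).card)) := by
    rw [← hA, hA', one_div]
  have h := crnLag_replicas_integral_SEsq_le (q := q) ν hw0' hmax Khat hK hf ha hc k N hR hZm hlaw hind (x₀ := cold)
  rw [hrate] at h
  rw [show (ρ cold)⁻¹ = (((∫ V, ∏ p : Plaquette d L, w (plaquetteHolonomy V p.1 p.2.1.1 p.2.1.2) ∂(Measure.pi fun _ : Edge d L => haarProbability G)) /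
        ((∫ g, w g ∂(haarProbability G)) ^ B.card * M ^ (Finset.univ \ B).card)))⁻¹ from by rw [← hrate, inv_inv]] at h
  rw [hπ'] at h
  exact h

/-- **DIFFERENT INITIAL COUPLINGS**: `E(H̄ − π f)² ≤ E[SE²] + ((1 − A)^{k+N}(c − a))²` (the exact one-plaquette heat-bath sampler (`A = Z/(c^{#B}M^k)`)). [ours] -/
theorem heatBath_crnLag_replicas_mse_le_SEsq_add [MeasurableSingletonClass G] (hL : 2 ≤ L) {w : G → ℝ} (hw : Continuous w) {m M : ℝ} (hm0 : 0 < m)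
    (hm : ∀ g, m ≤ w g) (hM : ∀ g, w g ≤ M) (hw1 : w 1 = M)
    (B : Finset (Plaquette d L)) (t : Plaquette d L → Edge d L)
    (ht : ∀ p ∈ B, t p ∈ ({(p.1, p.2.1.1), (p.1.shift p.2.1.1, p.2.1.2),
        (p.1.shift p.2.1.2, p.2.1.1), (p.1, p.2.1.2)} : Finset (Edge d L)))
    (rank : Plaquette d L → ℕ)
    (hrank : ∀ p ∈ B, ∀ p' ∈ B, p ≠ p' → t p ∈ ({(p'.1, p'.2.1.1), (p'.1.shift p'.2.1.1, p'.2.1.2),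
        (p'.1.shift p'.2.1.2, p'.2.1.1), (p'.1, p'.2.1.2)} : Finset (Edge d L)) → rank p < rank p')
    (π q : Measure (GaugeConfig d L G)) [IsProbabilityMeasure π] [IsProbabilityMeasure q]
    (hπ : π = (Measure.pi fun _ : Edge d L => haarProbability G).withDensity fun U =>
      ENNReal.ofReal ((∏ p : Plaquette d L, w (plaquetteHolonomy U p.1 p.2.1.1 p.2.1.2)) /
        ∫ V, ∏ p : Plaquette d L, w (plaquetteHolonomy V p.1 p.2.1.1 p.2.1.2)
          ∂(Measure.pi fun _ : Edge d L => haarProbability G)))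
    (hq : q = (Measure.pi fun _ : Edge d L => haarProbability G).withDensity fun U =>
      ENNReal.ofReal ((∏ p ∈ B, w (plaquetteHolonomy U p.1 p.2.1.1 p.2.1.2)) /
        ∫ V, ∏ p ∈ B, w (plaquetteHolonomy V p.1 p.2.1.1 p.2.1.2)
          ∂(Measure.pi fun _ : Edge d L => haarProbability G)))
    [Fact (Measurable (fun U =>
        ((∫ V, ∏ p : Plaquette d L, w (plaquetteHolonomy V p.1 p.2.1.1 p.2.1.2) ∂(Measure.pi fun _ : Edge d L => haarProbability G)) /
          ((∫ V, ∏ p ∈ B, w (plaquetteHolonomy V p.1 p.2.1.1 p.2.1.2)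
            ∂(Measure.pi fun _ : Edge d L => haarProbability G)) *
            ∏ p ∈ Finset.univ \ B, w (plaquetteHolonomy U p.1 p.2.1.1 p.2.1.2)))⁻¹))]
    (Khat : Kernel (GaugeConfig d L G × GaugeConfig d L G) (GaugeConfig d L G × GaugeConfig d L G))
    [IsMarkovKernel Khat]
    (hK : ∀ z : GaugeConfig d L G × GaugeConfig d L G, Khat z =
      (q.prod (volume : Measure unitInterval)).map (fun p : GaugeConfig d L G × unitInterval =>
        ((if (p.2 : ℝ) * (fun U =>
        ((∫ V, ∏ p : Plaquette d L, w (plaquetteHolonomy V p.1 p.2.1.1 p.2.1.2) ∂(Measure.pi fun _ : Edge d L => haarProbability G)) /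
          ((∫ V, ∏ p ∈ B, w (plaquetteHolonomy V p.1 p.2.1.1 p.2.1.2)
            ∂(Measure.pi fun _ : Edge d L => haarProbability G)) *
            ∏ p ∈ Finset.univ \ B, w (plaquetteHolonomy U p.1 p.2.1.1 p.2.1.2)))⁻¹) z.1 ≤ (fun U =>
        ((∫ V, ∏ p : Plaquette d L, w (plaquetteHolonomy V p.1 p.2.1.1 p.2.1.2) ∂(Measure.pi fun _ : Edge d L => haarProbability G)) /
          ((∫ V, ∏ p ∈ B, w (plaquetteHolonomy V p.1 p.2.1.1 p.2.1.2)
            ∂(Measure.pi fun _ : Edge d L => haarProbability G)) *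
            ∏ p ∈ Finset.univ \ B, w (plaquetteHolonomy U p.1 p.2.1.1 p.2.1.2)))⁻¹) p.1 then p.1 else z.1),
          (if (p.2 : ℝ) * (fun U =>
        ((∫ V, ∏ p : Plaquette d L, w (plaquetteHolonomy V p.1 p.2.1.1 p.2.1.2) ∂(Measure.pi fun _ : Edge d L => haarProbability G)) /
          ((∫ V, ∏ p ∈ B, w (plaquetteHolonomy V p.1 p.2.1.1 p.2.1.2)
            ∂(Measure.pi fun _ : Edge d L => haarProbability G)) *
            ∏ p ∈ Finset.univ \ B, w (plaquetteHolonomy U p.1 p.2.1.1 p.2.1.2)))⁻¹) z.2 ≤ (fun U =>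
        ((∫ V, ∏ p : Plaquette d L, w (plaquetteHolonomy V p.1 p.2.1.1 p.2.1.2) ∂(Measure.pi fun _ : Edge d L => haarProbability G)) /
          ((∫ V, ∏ p ∈ B, w (plaquetteHolonomy V p.1 p.2.1.1 p.2.1.2)
            ∂(Measure.pi fun _ : Edge d L => haarProbability G)) *
            ∏ p ∈ Finset.univ \ B, w (plaquetteHolonomy U p.1 p.2.1.1 p.2.1.2)))⁻¹) p.1 then p.1 else z.2))))
{Ω' : Type*} {mΩ' : MeasurableSpace Ω'} {μ : Measure Ω'} [IsProbabilityMeasure μ]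
    {Z : ℕ → Ω' → (ℕ → GaugeConfig d L G × GaugeConfig d L G)} {R : ℕ} {ν₀ : ℕ → Measure (GaugeConfig d L G × GaugeConfig d L G)} [∀ j, IsProbabilityMeasure (ν₀ j)]
    {f : GaugeConfig d L G → ℝ} (hf : Measurable f) {a c : ℝ} (ha : ∀ x, a ≤ f x) (hc : ∀ x, f x ≤ c) (k N : ℕ) (hR : 2 ≤ R) (hZm : ∀ j, Measurable (Z j))
    (hlaw : ∀ j < R, μ.map (Z j) = Kernel.trajMeasure (X := fun _ : ℕ => GaugeConfig d L G × GaugeConfig d L G) (ν₀ j)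
      (fun n : ℕ => Khat.comap (fun h : (i : ↥(Finset.Iic n)) → GaugeConfig d L G × GaugeConfig d L G => h ⟨n, Finset.mem_Iic.2 le_rfl⟩)
        (measurable_pi_apply _)))
    (hlag : ∀ j < R, (ν₀ j).map Prod.fst = ((ν₀ j).map Prod.snd).bind (indepMH q (fun U =>
        ((∫ V, ∏ p : Plaquette d L, w (plaquetteHolonomy V p.1 p.2.1.1 p.2.1.2) ∂(Measure.pi fun _ : Edge d L => haarProbability G)) /
          ((∫ V, ∏ p ∈ B, w (plaquetteHolonomy V p.1 p.2.1.1 p.2.1.2)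
            ∂(Measure.pi fun _ : Edge d L => haarProbability G)) *
            ∏ p ∈ Finset.univ \ B, w (plaquetteHolonomy U p.1 p.2.1.1 p.2.1.2)))⁻¹)))
    (hind : ∀ i < R, ∀ j < R, i ≠ j → IndepFun (Z i) (Z j) μ) :
    ∫ ω, (replicaMean (fun j ω => f ((Z j ω k).2) + ∑ n ∈ range N, (f ((Z j ω (k + n)).1) - f ((Z j ω (k + n)).2))) R ω -
        ∫ x, f x ∂(π)) ^ 2 ∂μ ≤
      μ[replicaSEsq (fun j ω => f ((Z j ω k).2) + ∑ n ∈ range N, (f ((Z j ω (k + n)).1) - f ((Z j ω (k + n)).2))) R] +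
        ((1 - (((∫ V, ∏ p : Plaquette d L, w (plaquetteHolonomy V p.1 p.2.1.1 p.2.1.2) ∂(Measure.pi fun _ : Edge d L => haarProbability G)) /
        ((∫ g, w g ∂(haarProbability G)) ^ B.card * M ^ (Finset.univ \ B).card)))) ^ (k + N) * (c - a)) ^ 2 := by
  obtain ⟨hA, hρq, hmax, hρm, hρpos⟩ := heatBath_cold_acceptMass_eq hL hw hm0 hm hM hw1 B t ht rank hrank π q hπ hq
  set cold : GaugeConfig d L G := fun _ => (1 : G) with hcold
  set ρ : GaugeConfig d L G → ℝ := fun U => ((∫ V, ∏ p : Plaquette d L, w (plaquetteHolonomy V p.1 p.2.1.1 p.2.1.2) ∂(Measure.pi fun _ : Edge d L => haarProbability G)) /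
          ((∫ V, ∏ p ∈ B, w (plaquetteHolonomy V p.1 p.2.1.1 p.2.1.2)
            ∂(Measure.pi fun _ : Edge d L => haarProbability G)) *
            ∏ p ∈ Finset.univ \ B, w (plaquetteHolonomy U p.1 p.2.1.1 p.2.1.2))) with hρ
  have hw0' : ∀ U, 0 < (ρ U)⁻¹ := fun U => inv_pos.2 (hρpos U)
  have hπ' : (q.withDensity fun U => ENNReal.ofReal (ρ U)⁻¹) = π := withDensity_inv_density hρm hρpos hρq
  haveI : IsProbabilityMeasure (q.withDensity fun U => ENNReal.ofReal (ρ U)⁻¹) := by rw [hπ']; infer_instance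
  have hone : ∫⁻ y, ENNReal.ofReal (ρ y)⁻¹ ∂q = ENNReal.ofReal 1 := by
    have h : π Set.univ = 1 := measure_univ
    rw [← hπ', withDensity_apply _ MeasurableSet.univ, Measure.restrict_univ] at h
    rw [h, ENNReal.ofReal_one]
  have hA' := imhAcceptMass_toReal_eq_of_forall_le (q := q) hw0' cold hmax zero_le_one hone
  have hrate : ((ρ cold)⁻¹)⁻¹ = ((∫ V, ∏ p : Plaquette d L, w (plaquetteHolonomy V p.1 p.2.1.1 p.2.1.2) ∂(Measure.pi fun _ : Edge d L => haarProbability G)) /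
        ((∫ g, w g ∂(haarProbability G)) ^ B.card * M ^ (Finset.univ \ B).card)) := by
    rw [← hA, hA', one_div]
  have h := crnLag_replicas_mse_le_SEsq_add (q := q) hw0' hmax Khat hK hf ha hc k N hR hZm hlaw hlag hind (x₀ := cold)
  rw [hrate] at h
  rw [hπ'] at h
  exact h

end Summit.Ventures.LatticeQCDFlow.Theory2.Autoregressive

end
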